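import Summits.QuantumFields.BalabanUV.T4Continuum.Support.SubstrateChartRealSlicePair
import Summits.QuantumFields.BalabanUV.T4Continuum.Support.SubstrateCovarianceChartBound

/-!
# SUBSTRATE — [dict] D-8 ∕ LIBRARY L-E12 follower W-17b (typer gen 9 RULING (λ13), journal l.17637): THE SPECIES INSTANCES ON THE TWO-RUN CHART —
# run A's and run B's Green operators (bounds `4∕γ_A`, `4∕γ_B`, p223952 ∕ p225952) and covariance entries (bounds `covBound`, W-15 p227479) along ONE pair
# disc `sliceDisc₂`, at a generic pair point and AT THE SECTION OF RECORD `sectionOfRecord D ι U` (centre = the section point; `hR⁰ ∕ hco ∕ hγ` discharged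
# by `transV_mem_unitaryGroup`, `coercive_vecOp_towerDataOf_of_regular`, `0 < gammaV`)

Cell `pub-balaban`, SUBSTRATE cell, seat `b2b-balaban-substrate-p1` (gen 4).  Summits-side under the LEAN PLACEMENT RULE.  Composition BY NAME of W-17
`SubstrateChartRealSlicePair` (`hslice_chi₂_each`, `pairPoint`, `pairPoint_sectionOfRecord_zero`, `sectionOfRecord_mem_unitaryLev₂`) with the single-factor species
letters: p225952 `analyticOnNhd_greenT_printed_on_ballExplicit`, p223952 `opNorm_greenT_le_on_ballExplicit` ∕ `analyticOnNhd_covAtTLev_printed_on_ballExplicit` ∕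
`rhoLev`, W-15 (substrate-p2 g4) `covBound` ∕ `norm_covAtTLev_le_on_ballExplicit`, p223342 `coercive_vecOp_towerDataOf_of_regular`, p217365 `transV_mem_unitaryGroup`.
Nothing restated; 0 `def`.

HONEST FRAMING: rung (B)+1 of the FINITE-VOLUME T⁴ programme — NOT infinite volume, NOT a mass gap, NOT Clay; spine PROVED 0∕9; NE5 NOT PRINTED ∕ NOT proved.
Composition only, 0 estimate: the Green bound `4∕γ` is p3's form-relative count, `covBound` is W-15's crude explicit letter (level-indexed through
`‖s k‖·(lev k)^{−d}`), the small-field letters `α τ` and `0 < gammaV` at the record are DISPLAYED; the ℰ-families' letter and `hreal` stay DISPLAYED (θ8);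
which chart the NE5 owner instantiates at is the OWNER's choice (typer (λ13)).  HONEST DEPENDENCY (cell line, verbatim): continuum YM on T⁴ ⇐ BetaPertH ∧
nine spine estimates (0/9 proved); BetaPertH ⇐ (D1) ∧ (D4) ∧ CAP+tail; G-an2-4 gates asym, D1 and NE2/3/4.

WHAT ([folklore]; the twelve binders = p225952 §3's six per run, token-wise: `hR₀A haA hcoA hγA hΓA hℓA`, `hR₀B haB hcoB hγB hΓB hℓB`).
* §0 `hslice₂_of_le` — pure logic: weaken the two closed-disc bounds of a seven-clause package to common∕larger letters (the consumer's `B·rOp k`).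
* §1 **`hslice_greenT_pair₂`** — the seven clauses of `operatorRate_complex_of_realSlice_each` at `𝒰 := TwoRunChart D o` for run A's Green operator of level `kA`
  (reading `(chi _ u.1)` ) and run B's of level `kB` (reading `(chi _ u.2)`), bounds `4∕γ_A`, `4∕γ_B`, at every pair point with `(1 + r⁻¹)‖A.1‖ < rhoLev_A`,
  `(1 + r⁻¹)‖A.2‖ < rhoLev_B`.
* §2 **`hslice_covAtTLev_pair₂`** — the same for a covariance ENTRY of each run (levels `kA kB : ℕ`, tags, bond pairs), bounds `covBound (D.F.P D.K) o γA sA kA`,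
  `covBound (D.F.P (D.K+1)) o γB sB kB` (W-15's `norm_covAtTLev_le_on_ballExplicit` on each factor).
* §3 AT THE SECTION OF RECORD (unitary `ι` with `‖ι g − 1‖ = dist1 g`; per run: small-field letters `α τ`, `0 < a′`, `0 < gammaV`, contour lengths): with centre
  `R⁰ := sectionOfRecord D ι U` and `A := 0` — **`hslice_greenT_pair₂_sectionOfRecord`**, **`hslice_covAtTLev_pair₂_sectionOfRecord`** (the curve passes through
  the section point itself; radii `rhoLev_A (gammaV_A) ∕ rhoLev_B (gammaV_B)`, smallness automatic).
-/

noncomputable section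

open scoped BigOperators ComplexConjugate Matrix Matrix.Norms.L2Operator Kronecker ComplexOrder
open Complex (I)

namespace Summit.QuantumFields.BalabanUV.T4Continuum.SubstrateChartRealSlicePairSpecies

open Literature.MathematicalPhysics.QuantumFieldTheory.Balaban1983to89
open Literature.MathematicalPhysics.QuantumFieldTheory.Balaban1983to89.B5Prop11Plancherel (Tor fine)
open Literature.MathematicalPhysics.QuantumFieldTheory.Balaban1983to89.B5G183RateUnitTower (lev lev_neZero)
open Summit.QuantumFields.BalabanUV.T4Continuum
open Summit.QuantumFields.BalabanUV.T4Continuum.CoerciveInverseTower (Coercive)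
open Summit.QuantumFields.BalabanUV.T4Continuum.CovariantVectorCoercive (vecOp gammaV)
open Summit.QuantumFields.BalabanUV.T4Continuum.CovariantBlockAveraging (ContourSystem transport)
open Summit.QuantumFields.BalabanUV.T4Continuum.SubstrateBackgroundTransporters (unitMod transV_mem_unitaryGroup)
open Summit.QuantumFields.BalabanUV.T4Continuum.SubstrateTransporterSpecies
open Summit.QuantumFields.BalabanUV.T4Continuum.SubstrateTransporterSpeciesHolo (expChartT expChartInvT)
open Summit.QuantumFields.BalabanUV.T4Continuum.SubstrateTransporterSpeciesLev (cPr aPr covAtTLev coercive_vecOp_towerDataOf_of_regular)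
open Summit.QuantumFields.BalabanUV.T4Continuum.SubstrateTransporterSpeciesLevExplicit (rhoLev rhoLev_pos opNorm_greenT_le_on_ballExplicit
  analyticOnNhd_covAtTLev_printed_on_ballExplicit)
open Summit.QuantumFields.BalabanUV.T4Continuum.SubstrateChartSection (chi sectionOfRecord TwoRunChart)
open Summit.QuantumFields.BalabanUV.T4Continuum.SubstrateChartRealSlice (unitaryLev unitaryLev₂ sectionOfRecord_mem_unitaryLev₂)
open Summit.QuantumFields.BalabanUV.T4Continuum.SubstrateChartRealSliceSpecies (analyticOnNhd_greenT_printed_on_ballExplicit)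
open Summit.QuantumFields.BalabanUV.T4Continuum.SubstrateChartRealSlicePair
open Summit.QuantumFields.BalabanUV.T4Continuum.SubstrateCovarianceChartBound (covBound norm_covAtTLev_le_on_ballExplicit)
open Summit.QuantumFields.BalabanUV.T4Continuum.SubstrateTwoRunsDriven (DrivenRuns)

variable {G : Type} [GaugeGroup G] (D : DrivenRuns G) {o : Type} [Fintype o] [DecidableEq o] [Nonempty o]
variable (ΓA : (k : ℕ) → ContourSystem (D.F.P D.K).d (lev (D.F.P D.K).L k) (unitMod (D.F.P D.K)))
  (ΓB : (k : ℕ) → ContourSystem (D.F.P (D.K + 1)).d (lev (D.F.P (D.K + 1)).L k) (unitMod (D.F.P (D.K + 1))))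

/-! ## §0 Weakening the two closed-disc bounds of a seven-clause package (pure logic; for consumers reading both families at ONE common letter `B·rOp k`) -/

omit [Nonempty o] in
/-- [folklore] **COMMON-LETTER FORM**: a seven-clause package on the pair chart with closed-disc bounds `CA`, `CB` yields the same package with any larger bounds
`CA′ ≥ CA`, `CB′ ≥ CB` (e.g. both `:= B·rOp k`, the consumer's letter in `operatorRate_complex_of_realSlice_each`).  The families are explicit arguments. -/
theorem hslice₂_of_le {EA EB : Type*} [NormedAddCommGroup EA] [NormedSpace ℂ EA] [NormedAddCommGroup EB] [NormedSpace ℂ EB]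
    (FA : TwoRunChart D o → EA) (FB : TwoRunChart D o → EB) {u : TwoRunChart D o} {r CA CB CA' CB' : ℝ} (hCA : CA ≤ CA') (hCB : CB ≤ CB')
    (h : ∃ γ : ℂ → TwoRunChart D o, ∃ z₀ : ℂ, ‖z₀‖ ≤ r ∧ γ z₀ = u ∧ (∀ x : ℝ, |x| < 1 → γ x ∈ unitaryLev₂ D) ∧
      DiffContOnCl ℂ (fun z => FA (γ z)) (Metric.ball (0 : ℂ) 1) ∧ DiffContOnCl ℂ (fun z => FB (γ z)) (Metric.ball (0 : ℂ) 1) ∧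
      (∀ z : ℂ, ‖z‖ ≤ 1 → ‖FA (γ z)‖ ≤ CA) ∧ ∀ z : ℂ, ‖z‖ ≤ 1 → ‖FB (γ z)‖ ≤ CB) :
    ∃ γ : ℂ → TwoRunChart D o, ∃ z₀ : ℂ, ‖z₀‖ ≤ r ∧ γ z₀ = u ∧ (∀ x : ℝ, |x| < 1 → γ x ∈ unitaryLev₂ D) ∧
      DiffContOnCl ℂ (fun z => FA (γ z)) (Metric.ball (0 : ℂ) 1) ∧ DiffContOnCl ℂ (fun z => FB (γ z)) (Metric.ball (0 : ℂ) 1) ∧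
      (∀ z : ℂ, ‖z‖ ≤ 1 → ‖FA (γ z)‖ ≤ CA') ∧ ∀ z : ℂ, ‖z‖ ≤ 1 → ‖FB (γ z)‖ ≤ CB' := by
  obtain ⟨γ, z₀, hz₀, hu, hreal, hdA, hdB, hbA, hbB⟩ := h
  exact ⟨γ, z₀, hz₀, hu, hreal, hdA, hdB, fun z hz => (hbA z hz).trans hCA, fun z hz => (hbB z hz).trans hCB⟩

/-! ## §1–§2 The two runs' species along ONE pair disc, generic centre -/

section Generic

variable {R₀ : TwoRunChart D o}
  (hR₀A : ∀ (k : Fin ((D.F.P D.K).K + 1)) ν i, R₀.1 k ν i ∈ Matrix.unitaryGroup o ℂ)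
  (hR₀B : ∀ (k : Fin ((D.F.P (D.K + 1)).K + 1)) ν i, R₀.2 k ν i ∈ Matrix.unitaryGroup o ℂ)
  {aA γA aB γB : ℝ} (haA : 0 ≤ aA) (haB : 0 ≤ aB)
  (hcoA : ∀ k : Fin ((D.F.P D.K).K + 1), Coercive γA (vecOp (lev (D.F.P D.K).L k) (unitMod (D.F.P D.K)) aA (ΓA k) (R₀.1 k)))
  (hcoB : ∀ k : Fin ((D.F.P (D.K + 1)).K + 1), Coercive γB (vecOp (lev (D.F.P (D.K + 1)).L k) (unitMod (D.F.P (D.K + 1))) aB (ΓB k) (R₀.2 k)))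
  (hγA : 0 < γA) (hγB : 0 < γB)
  {ℓA : Fin ((D.F.P D.K).K + 1) → ℕ} {ℓB : Fin ((D.F.P (D.K + 1)).K + 1) → ℕ}
  (hΓA : ∀ (k : Fin ((D.F.P D.K).K + 1)) y j μ (t : Fin (lev (D.F.P D.K).L k)), (ΓA k y j μ t).length ≤ ℓA k)
  (hΓB : ∀ (k : Fin ((D.F.P (D.K + 1)).K + 1)) y j μ (t : Fin (lev (D.F.P (D.K + 1)).L k)), (ΓB k y j μ t).length ≤ ℓB k)
  (hℓA : ∀ k : Fin ((D.F.P D.K).K + 1), (ℓA k : ℝ) ≤ (((D.F.P D.K).d : ℝ) + 1) * (lev (D.F.P D.K).L k : ℕ))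
  (hℓB : ∀ k : Fin ((D.F.P (D.K + 1)).K + 1), (ℓB k : ℝ) ≤ (((D.F.P (D.K + 1)).d : ℝ) + 1) * (lev (D.F.P (D.K + 1)).L k : ℕ))

include hR₀A hR₀B haA haB hcoA hcoB hγA hγB hΓA hΓB hℓA hℓB in
/-- [folklore] **RUN A's AND RUN B's GREEN OPERATORS ALONG ONE PAIR DISC — ALL SEVEN CLAUSES PROVED** (bounds `4∕γ_A`, `4∕γ_B`): at the printed letters of each run,
for a centre with BOTH factors unitary and levelwise coercive, a common depth `0 < r`, levels `kA`, `kB`, and a pair of coordinates in the two explicit balls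
`(1 + r⁻¹)‖A.1‖ < rhoLev_A`, `(1 + r⁻¹)‖A.2‖ < rhoLev_B` — the `hslice` binder of `operatorRate_complex_of_realSlice_each` at `𝒰 := TwoRunChart D o` for the Green families. -/
theorem hslice_greenT_pair₂ {r : ℝ} (hr : 0 < r) (kA : Fin ((D.F.P D.K).K + 1)) (kB : Fin ((D.F.P (D.K + 1)).K + 1)) (A : TwoRunChart D o)
    (hA1 : (1 + r⁻¹) * ‖A.1‖ < rhoLev (D.F.P D.K) (o := o) γA aA) (hA2 : (1 + r⁻¹) * ‖A.2‖ < rhoLev (D.F.P (D.K + 1)) (o := o) γB aB) :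
    ∃ γ : ℂ → TwoRunChart D o, ∃ z₀ : ℂ, ‖z₀‖ ≤ r ∧ γ z₀ = pairPoint D R₀ A ∧ (∀ x : ℝ, |x| < 1 → γ x ∈ unitaryLev₂ D) ∧
      DiffContOnCl ℂ (fun z => greenT (lev (D.F.P D.K).L kA) (unitMod (D.F.P D.K)) (cPr (D.F.P D.K) kA) (aPr (D.F.P D.K) aA kA) (ΓA kA)
        ((chi _ (γ z).1).1 kA) ((chi _ (γ z).1).2 kA)) (Metric.ball (0 : ℂ) 1) ∧
      DiffContOnCl ℂ (fun z => greenT (lev (D.F.P (D.K + 1)).L kB) (unitMod (D.F.P (D.K + 1))) (cPr (D.F.P (D.K + 1)) kB) (aPr (D.F.P (D.K + 1)) aB kB)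
        (ΓB kB) ((chi _ (γ z).2).1 kB) ((chi _ (γ z).2).2 kB)) (Metric.ball (0 : ℂ) 1) ∧
      (∀ z : ℂ, ‖z‖ ≤ 1 → ‖greenT (lev (D.F.P D.K).L kA) (unitMod (D.F.P D.K)) (cPr (D.F.P D.K) kA) (aPr (D.F.P D.K) aA kA) (ΓA kA)
        ((chi _ (γ z).1).1 kA) ((chi _ (γ z).1).2 kA)‖ ≤ 4 / γA) ∧
      ∀ z : ℂ, ‖z‖ ≤ 1 → ‖greenT (lev (D.F.P (D.K + 1)).L kB) (unitMod (D.F.P (D.K + 1))) (cPr (D.F.P (D.K + 1)) kB) (aPr (D.F.P (D.K + 1)) aB kB)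
        (ΓB kB) ((chi _ (γ z).2).1 kB) ((chi _ (γ z).2).2 kB)‖ ≤ 4 / γB :=
  hslice_chi₂_each D ⟨fun k ν i => hR₀A k ν i, fun k ν i => hR₀B k ν i⟩
    (fun RS => greenT (lev (D.F.P D.K).L kA) (unitMod (D.F.P D.K)) (cPr (D.F.P D.K) kA) (aPr (D.F.P D.K) aA kA) (ΓA kA) (RS.1 kA) (RS.2 kA))
    (fun RS => greenT (lev (D.F.P (D.K + 1)).L kB) (unitMod (D.F.P (D.K + 1))) (cPr (D.F.P (D.K + 1)) kB) (aPr (D.F.P (D.K + 1)) aB kB) (ΓB kB)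
      (RS.1 kB) (RS.2 kB)) hr
    (analyticOnNhd_greenT_printed_on_ballExplicit _ ΓA hR₀A haA hcoA hγA hΓA hℓA kA)
    (fun _ hB => opNorm_greenT_le_on_ballExplicit _ ΓA hR₀A haA hcoA hγA hΓA hℓA hB kA)
    (analyticOnNhd_greenT_printed_on_ballExplicit _ ΓB hR₀B haB hcoB hγB hΓB hℓB kB)
    (fun _ hB => opNorm_greenT_le_on_ballExplicit _ ΓB hR₀B haB hcoB hγB hΓB hℓB hB kB) A hA1 hA2

variable (sA sB : ℕ → ℂ)

include hR₀A hR₀B haA haB hcoA hcoB hγA hγB hΓA hΓB hℓA hℓB in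
/-- [folklore] **RUN A's AND RUN B's COVARIANCE ENTRIES ALONG ONE PAIR DISC — ALL SEVEN CLAUSES PROVED** (bounds W-15's `covBound` per run): levels `kA kB : ℕ`
(levels above the run's top read `0`), tags `tA tB`, bond pairs; analyticity by p223952 `analyticOnNhd_covAtTLev_printed_on_ballExplicit`, bounds by W-15
`norm_covAtTLev_le_on_ballExplicit`, on each factor. -/
theorem hslice_covAtTLev_pair₂ {r : ℝ} (hr : 0 < r) (kA kB : ℕ) {TA TB : Type*} (tA : TA) (tB : TB)
    (bA bA' : (Tor (unitMod (D.F.P D.K)) × Fin (D.F.P D.K).d) × o) (bB bB' : (Tor (unitMod (D.F.P (D.K + 1))) × Fin (D.F.P (D.K + 1)).d) × o)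
    (A : TwoRunChart D o) (hA1 : (1 + r⁻¹) * ‖A.1‖ < rhoLev (D.F.P D.K) (o := o) γA aA)
    (hA2 : (1 + r⁻¹) * ‖A.2‖ < rhoLev (D.F.P (D.K + 1)) (o := o) γB aB) :
    ∃ γ : ℂ → TwoRunChart D o, ∃ z₀ : ℂ, ‖z₀‖ ≤ r ∧ γ z₀ = pairPoint D R₀ A ∧ (∀ x : ℝ, |x| < 1 → γ x ∈ unitaryLev₂ D) ∧
      DiffContOnCl ℂ (fun z => covAtTLev (D.F.P D.K) (cPr (D.F.P D.K)) (aPr (D.F.P D.K) aA) ΓA sA (chi _ (γ z).1).1 (chi _ (γ z).1).2 kA tA bA bA')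
        (Metric.ball (0 : ℂ) 1) ∧
      DiffContOnCl ℂ (fun z => covAtTLev (D.F.P (D.K + 1)) (cPr (D.F.P (D.K + 1))) (aPr (D.F.P (D.K + 1)) aB) ΓB sB (chi _ (γ z).2).1 (chi _ (γ z).2).2
        kB tB bB bB') (Metric.ball (0 : ℂ) 1) ∧
      (∀ z : ℂ, ‖z‖ ≤ 1 → ‖covAtTLev (D.F.P D.K) (cPr (D.F.P D.K)) (aPr (D.F.P D.K) aA) ΓA sA (chi _ (γ z).1).1 (chi _ (γ z).1).2 kA tA bA bA'‖
        ≤ covBound (D.F.P D.K) o γA sA kA) ∧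
      ∀ z : ℂ, ‖z‖ ≤ 1 → ‖covAtTLev (D.F.P (D.K + 1)) (cPr (D.F.P (D.K + 1))) (aPr (D.F.P (D.K + 1)) aB) ΓB sB (chi _ (γ z).2).1 (chi _ (γ z).2).2
        kB tB bB bB'‖ ≤ covBound (D.F.P (D.K + 1)) o γB sB kB :=
  hslice_chi₂_each D ⟨fun k ν i => hR₀A k ν i, fun k ν i => hR₀B k ν i⟩
    (fun RS => covAtTLev (D.F.P D.K) (cPr (D.F.P D.K)) (aPr (D.F.P D.K) aA) ΓA sA RS.1 RS.2 kA tA bA bA')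
    (fun RS => covAtTLev (D.F.P (D.K + 1)) (cPr (D.F.P (D.K + 1))) (aPr (D.F.P (D.K + 1)) aB) ΓB sB RS.1 RS.2 kB tB bB bB') hr
    (analyticOnNhd_covAtTLev_printed_on_ballExplicit _ ΓA hR₀A haA hcoA hγA hΓA hℓA sA kA tA bA bA')
    (fun _ hB => norm_covAtTLev_le_on_ballExplicit _ ΓA hR₀A haA hcoA hγA hΓA hℓA sA kA tA bA bA' hB)
    (analyticOnNhd_covAtTLev_printed_on_ballExplicit _ ΓB hR₀B haB hcoB hγB hΓB hℓB sB kB tB bB bB')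
    (fun _ hB => norm_covAtTLev_le_on_ballExplicit _ ΓB hR₀B haB hcoB hγB hΓB hℓB sB kB tB bB bB' hB) A hA1 hA2

end Generic

/-! ## §3 At the section of record: centre = the section point, `A = 0` -/

section Record

variable (ι : G →* Matrix o o ℂ) (hι : ∀ g, ι g ∈ Matrix.unitaryGroup o ℂ) (hdist : ∀ g : G, ‖ι g - 1‖ = dist1 g) (U : D.carriers.BgB)
  {aA αA τA aB αB τB : ℝ} (haA : 0 < aA) (hαA : 0 ≤ αA) (hτA : 0 ≤ τA) (haB : 0 < aB) (hαB : 0 ≤ αB) (hτB : 0 ≤ τB)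
  (hUA : ∀ (k : Fin ((D.F.P D.K).K + 1)) (b : PBond (D.F.P D.K) ((D.F.P D.K).K - k)),
    ((lev (D.F.P D.K).L k : ℕ) : ℝ) * dist1 (Averaging.iter D.avA ((D.F.P D.K).K - k) (D.carriers.transport U).1 b) ≤ αA)
  (hTA : ∀ (k : Fin ((D.F.P D.K).K + 1)) y jj μ (t : Fin (lev (D.F.P D.K).L k)),
    ‖transport (fine (lev (D.F.P D.K).L k) (unitMod (D.F.P D.K))) ((sectionOfRecord D ι U).1 k) μ (ΓA k y jj μ t) - 1‖ ≤ τA)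
  (hUB : ∀ (k : Fin ((D.F.P (D.K + 1)).K + 1)) (b : PBond (D.F.P (D.K + 1)) ((D.F.P (D.K + 1)).K - k)),
    ((lev (D.F.P (D.K + 1)).L k : ℕ) : ℝ) * dist1 (Averaging.iter D.avB ((D.F.P (D.K + 1)).K - k) U.1 b) ≤ αB)
  (hTB : ∀ (k : Fin ((D.F.P (D.K + 1)).K + 1)) y jj μ (t : Fin (lev (D.F.P (D.K + 1)).L k)),
    ‖transport (fine (lev (D.F.P (D.K + 1)).L k) (unitMod (D.F.P (D.K + 1)))) ((sectionOfRecord D ι U).2 k) μ (ΓB k y jj μ t) - 1‖ ≤ τB)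
  (hγVA : 0 < gammaV (Fintype.card o) (D.F.P D.K).d aA αA τA) (hγVB : 0 < gammaV (Fintype.card o) (D.F.P (D.K + 1)).d aB αB τB)
  {ℓA : Fin ((D.F.P D.K).K + 1) → ℕ} {ℓB : Fin ((D.F.P (D.K + 1)).K + 1) → ℕ}
  (hΓA : ∀ (k : Fin ((D.F.P D.K).K + 1)) y j μ (t : Fin (lev (D.F.P D.K).L k)), (ΓA k y j μ t).length ≤ ℓA k)
  (hΓB : ∀ (k : Fin ((D.F.P (D.K + 1)).K + 1)) y j μ (t : Fin (lev (D.F.P (D.K + 1)).L k)), (ΓB k y j μ t).length ≤ ℓB k)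
  (hℓA : ∀ k : Fin ((D.F.P D.K).K + 1), (ℓA k : ℝ) ≤ (((D.F.P D.K).d : ℝ) + 1) * (lev (D.F.P D.K).L k : ℕ))
  (hℓB : ∀ k : Fin ((D.F.P (D.K + 1)).K + 1), (ℓB k : ℝ) ≤ (((D.F.P (D.K + 1)).d : ℝ) + 1) * (lev (D.F.P (D.K + 1)).L k : ℕ))

include hι hdist haA hαA hτA haB hαB hτB hUA hTA hUB hTB hγVA hγVB hΓA hΓB hℓA hℓB in
/-- [folklore] **THE TWO RUNS' GREEN OPERATORS ALONG ONE DISC THROUGH THE SECTION POINT** `sectionOfRecord D ι U` (levels `kA kB`, any depth `0 < r`):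
`hslice_greenT_pair₂` with centre := the section point (unitary: `transV_mem_unitaryGroup`; coercive with the LEVEL-FREE `gammaV_A ∕ gammaV_B`:
`coercive_vecOp_towerDataOf_of_regular` from the displayed small-field letters of run A's field `(C.transport U).1` and run B's field `U.1`) and `A := 0`. -/
theorem hslice_greenT_pair₂_sectionOfRecord {r : ℝ} (hr : 0 < r) (kA : Fin ((D.F.P D.K).K + 1)) (kB : Fin ((D.F.P (D.K + 1)).K + 1)) :
    ∃ γ : ℂ → TwoRunChart D o, ∃ z₀ : ℂ, ‖z₀‖ ≤ r ∧ γ z₀ = sectionOfRecord D ι U ∧ (∀ x : ℝ, |x| < 1 → γ x ∈ unitaryLev₂ D) ∧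
      DiffContOnCl ℂ (fun z => greenT (lev (D.F.P D.K).L kA) (unitMod (D.F.P D.K)) (cPr (D.F.P D.K) kA) (aPr (D.F.P D.K) aA kA) (ΓA kA)
        ((chi _ (γ z).1).1 kA) ((chi _ (γ z).1).2 kA)) (Metric.ball (0 : ℂ) 1) ∧
      DiffContOnCl ℂ (fun z => greenT (lev (D.F.P (D.K + 1)).L kB) (unitMod (D.F.P (D.K + 1))) (cPr (D.F.P (D.K + 1)) kB) (aPr (D.F.P (D.K + 1)) aB kB)
        (ΓB kB) ((chi _ (γ z).2).1 kB) ((chi _ (γ z).2).2 kB)) (Metric.ball (0 : ℂ) 1) ∧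
      (∀ z : ℂ, ‖z‖ ≤ 1 → ‖greenT (lev (D.F.P D.K).L kA) (unitMod (D.F.P D.K)) (cPr (D.F.P D.K) kA) (aPr (D.F.P D.K) aA kA) (ΓA kA)
        ((chi _ (γ z).1).1 kA) ((chi _ (γ z).1).2 kA)‖ ≤ 4 / gammaV (Fintype.card o) (D.F.P D.K).d aA αA τA) ∧
      ∀ z : ℂ, ‖z‖ ≤ 1 → ‖greenT (lev (D.F.P (D.K + 1)).L kB) (unitMod (D.F.P (D.K + 1))) (cPr (D.F.P (D.K + 1)) kB) (aPr (D.F.P (D.K + 1)) aB kB)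
        (ΓB kB) ((chi _ (γ z).2).1 kB) ((chi _ (γ z).2).2 kB)‖ ≤ 4 / gammaV (Fintype.card o) (D.F.P (D.K + 1)).d aB αB τB := by
  have h := hslice_greenT_pair₂ D ΓA ΓB (R₀ := sectionOfRecord D ι U)
    (fun k ν i => transV_mem_unitaryGroup _ hι (Averaging.iter D.avA ((D.F.P D.K).K - k) (D.carriers.transport U).1) ν i)
    (fun k ν i => transV_mem_unitaryGroup _ hι (Averaging.iter D.avB ((D.F.P (D.K + 1)).K - k) U.1) ν i) haA.le haB.le
    (coercive_vecOp_towerDataOf_of_regular _ ΓA ι D.avA hdist (D.carriers.transport U).1 haA hαA hτA hUA hTA)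
    (coercive_vecOp_towerDataOf_of_regular _ ΓB ι D.avB hdist U.1 haB hαB hτB hUB hTB) hγVA hγVB hΓA hΓB hℓA hℓB hr kA kB 0
    (by rw [Prod.fst_zero, norm_zero, mul_zero]; exact rhoLev_pos _ haA.le hγVA)
    (by rw [Prod.snd_zero, norm_zero, mul_zero]; exact rhoLev_pos _ haB.le hγVB)
  rwa [pairPoint_sectionOfRecord_zero] at h

variable (sA sB : ℕ → ℂ)

include hι hdist haA hαA hτA haB hαB hτB hUA hTA hUB hTB hγVA hγVB hΓA hΓB hℓA hℓB in
/-- [folklore] **THE TWO RUNS' COVARIANCE ENTRIES ALONG ONE DISC THROUGH THE SECTION POINT** (`hslice_covAtTLev_pair₂` at the section point, `A := 0`;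
bounds `covBound … gammaV_A sA kA`, `covBound … gammaV_B sB kB`). -/
theorem hslice_covAtTLev_pair₂_sectionOfRecord {r : ℝ} (hr : 0 < r) (kA kB : ℕ) {TA TB : Type*} (tA : TA) (tB : TB)
    (bA bA' : (Tor (unitMod (D.F.P D.K)) × Fin (D.F.P D.K).d) × o) (bB bB' : (Tor (unitMod (D.F.P (D.K + 1))) × Fin (D.F.P (D.K + 1)).d) × o) :
    ∃ γ : ℂ → TwoRunChart D o, ∃ z₀ : ℂ, ‖z₀‖ ≤ r ∧ γ z₀ = sectionOfRecord D ι U ∧ (∀ x : ℝ, |x| < 1 → γ x ∈ unitaryLev₂ D) ∧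
      DiffContOnCl ℂ (fun z => covAtTLev (D.F.P D.K) (cPr (D.F.P D.K)) (aPr (D.F.P D.K) aA) ΓA sA (chi _ (γ z).1).1 (chi _ (γ z).1).2 kA tA bA bA')
        (Metric.ball (0 : ℂ) 1) ∧
      DiffContOnCl ℂ (fun z => covAtTLev (D.F.P (D.K + 1)) (cPr (D.F.P (D.K + 1))) (aPr (D.F.P (D.K + 1)) aB) ΓB sB (chi _ (γ z).2).1 (chi _ (γ z).2).2
        kB tB bB bB') (Metric.ball (0 : ℂ) 1) ∧
      (∀ z : ℂ, ‖z‖ ≤ 1 → ‖covAtTLev (D.F.P D.K) (cPr (D.F.P D.K)) (aPr (D.F.P D.K) aA) ΓA sA (chi _ (γ z).1).1 (chi _ (γ z).1).2 kA tA bA bA'‖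
        ≤ covBound (D.F.P D.K) o (gammaV (Fintype.card o) (D.F.P D.K).d aA αA τA) sA kA) ∧
      ∀ z : ℂ, ‖z‖ ≤ 1 → ‖covAtTLev (D.F.P (D.K + 1)) (cPr (D.F.P (D.K + 1))) (aPr (D.F.P (D.K + 1)) aB) ΓB sB (chi _ (γ z).2).1 (chi _ (γ z).2).2
        kB tB bB bB'‖ ≤ covBound (D.F.P (D.K + 1)) o (gammaV (Fintype.card o) (D.F.P (D.K + 1)).d aB αB τB) sB kB := by
  have h := hslice_covAtTLev_pair₂ D ΓA ΓB (R₀ := sectionOfRecord D ι U)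
    (fun k ν i => transV_mem_unitaryGroup _ hι (Averaging.iter D.avA ((D.F.P D.K).K - k) (D.carriers.transport U).1) ν i)
    (fun k ν i => transV_mem_unitaryGroup _ hι (Averaging.iter D.avB ((D.F.P (D.K + 1)).K - k) U.1) ν i) haA.le haB.le
    (coercive_vecOp_towerDataOf_of_regular _ ΓA ι D.avA hdist (D.carriers.transport U).1 haA hαA hτA hUA hTA)
    (coercive_vecOp_towerDataOf_of_regular _ ΓB ι D.avB hdist U.1 haB hαB hτB hUB hTB) hγVA hγVB hΓA hΓB hℓA hℓB sA sB hr kA kB tA tB bA bA' bB bB' 0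
    (by rw [Prod.fst_zero, norm_zero, mul_zero]; exact rhoLev_pos _ haA.le hγVA)
    (by rw [Prod.snd_zero, norm_zero, mul_zero]; exact rhoLev_pos _ haB.le hγVB)
  rwa [pairPoint_sectionOfRecord_zero] at h

end Record

end Summit.QuantumFields.BalabanUV.T4Continuum.SubstrateChartRealSlicePairSpecies

end
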